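import Summits.CriticalPhenomena.PercolationContinuityZ3.Theorems.Transplant.SkelPhiNegReachRoomsCx
import HarnessLib

/-!
# N1 (the `{±1}` node), (C) column file (C-S9e): THE ROOMS OF THE y′-BAND (v-corridor, `du.1 = 1`) at the record values of RULING B.15/B.16 — for the
# windowed y′-band `yPrmXw n ℓ h v T q_y 799 Wmy Wpy` read in `runX φ c₀ n h 1` with the corridor sign `σ = sgOf du` (along axis `1 = ⌊β′/U⌋`, across
# the raw `α`, DRIFTING by `v` per stride): (§1) the window-unit facts `nℓ < U·W_B ≤ nℓ + U`, `W_B − 3 ≤ sA ≤ W_B − 2`, the anchor mismatch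
# `j·(U·W_B − Δ) ≤ 800·(n + U)` (`nℓ − n < Δ ≤ nℓ`), the band's corner values; (§2) **every region `j ≤ 799` reads inside the rooms** from three BAND
# FLOORS `hby1/hby2` (along, axis `1`) and `hby3` (across: the drifting-box budget of `readAcross0_drift` with `B := Wmy + Wpy + 800T + n`,
# `ρ := 2397 + q_y + 800T + La`, `E := 800·(n + U)`, `Y := 2r₀`). The last core and the habitat points: (C-S9f) `SkelPhiNegReachRoomsCyL`.

builds on p205010 (kernel theorem, internal audit signed; external expert review pending) — nothing in this file uses p205010; nothing here is a
claim about the open node `SamePDropOfSkeletonNeg`.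
Lane `prim-bschramm`, seat `prim-bschramm-p5` (gen 9; (C) lineage); helper file (`--supports stmt-CriticalPhenomena-4575`).
[cite: KozmaNitzan2024, §4 Lemma 11 (pp. 22–23), Lemma 12 (pp. 23–25), p. 26 (M_v, H_{v,x})] [cite: MartineauTassion2017, §3.2 Lemma 3.5, §4.3 Lemma 4.2]
-/

noncomputable section

namespace Summit.CriticalPhenomena.PercolationContinuityZ3.Theorems

namespace Transplant

namespace Skelφ

namespace CorrRec

open Literature.Probability.Percolation Literature.Probability.LatticeModels
open Literature.Probability.Percolation.KozmaNitzan.Cells (oth oth_ne sgOf sgOf_sign eq_oth_of_ne)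
open TwoAxis.Para (modulus)
open ChainPlanar ChainPara

/-- `oth 1 = 0` on `Fin 2`. [folklore] -/
private theorem oth_one' : oth (1 : Fin 2) = 0 := by decide

/-! ## §1 Window-unit facts and corners -/

/-- **`nℓ < U·W_B ≤ nℓ + U`** (`W_B = ⌊nℓ/U⌋ + 1`, `U = n + |h| ≥ 1`). [folklore] -/
theorem UQw_bounds {n : ℕ} (hn : 1 ≤ n) (ℓ : ℕ) (h : ℤ) :
    (n : ℤ) * ℓ < (shearUnit n h : ℤ) * (Qw n ℓ h : ℕ) ∧ (shearUnit n h : ℤ) * (Qw n ℓ h : ℕ) ≤ (n : ℤ) * ℓ + shearUnit n h := by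
  have hU : 1 ≤ shearUnit n h := by unfold shearUnit; omega
  have h1 : shearUnit n h * (n * ℓ / shearUnit n h) ≤ n * ℓ := Nat.mul_div_le (n * ℓ) (shearUnit n h)
  have h2 : n * ℓ < shearUnit n h * (n * ℓ / shearUnit n h) + shearUnit n h := by
    have := Nat.mod_lt (n * ℓ) (show 0 < shearUnit n h by omega)
    have := Nat.div_add_mod (n * ℓ) (shearUnit n h)
    nlinarith
  unfold Qw
  constructor
  · have : n * ℓ < shearUnit n h * (n * ℓ / shearUnit n h + 1) := by rw [Nat.mul_add, Nat.mul_one]; exact h2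
    exact_mod_cast this
  · have : shearUnit n h * (n * ℓ / shearUnit n h + 1) ≤ n * ℓ + shearUnit n h := by rw [Nat.mul_add, Nat.mul_one]; omega
    exact_mod_cast this

/-- **`W_B − 3 ≤ sA ≤ W_B − 2`** (the floored along readings of a v-stride span at most three units). [folklore] -/
theorem sA_bounds {n : ℕ} (hn : 1 ≤ n) (ℓ : ℕ) (h : ℤ) : ((Qw n ℓ h : ℕ) : ℤ) - 3 ≤ sA n ℓ h ∧ sA n ℓ h ≤ ((Qw n ℓ h : ℕ) : ℤ) - 2 := by
  have hU : (0 : ℤ) < (shearUnit n h : ℕ) := shearUnit_pos hn h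
  have hQ : ((Qw n ℓ h : ℕ) : ℤ) = (n : ℤ) * ℓ / (shearUnit n h : ℕ) + 1 := by unfold Qw; push_cast; rfl
  have e : ((n : ℤ) * ℓ - (shearUnit n h : ℕ) + 1) / (shearUnit n h : ℕ) = ((n : ℤ) * ℓ + 1) / (shearUnit n h : ℕ) - 1 := by
    have := Int.add_mul_ediv_right ((n : ℤ) * ℓ + 1) (-1) hU.ne'
    rw [show (n : ℤ) * ℓ + 1 + -1 * (shearUnit n h : ℕ) = (n : ℤ) * ℓ - (shearUnit n h : ℕ) + 1 by ring] at this
    rw [this]; ring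
  unfold sA; rw [hQ, e]
  have h1 : (n : ℤ) * ℓ / (shearUnit n h : ℕ) ≤ ((n : ℤ) * ℓ + 1) / (shearUnit n h : ℕ) := Int.ediv_le_ediv hU (by linarith)
  have h2 : ((n : ℤ) * ℓ + 1) / (shearUnit n h : ℕ) ≤ (n : ℤ) * ℓ / (shearUnit n h : ℕ) + 1 := by
    have : ((n : ℤ) * ℓ + 1) / (shearUnit n h : ℕ) ≤ ((n : ℤ) * ℓ + (shearUnit n h : ℕ)) / (shearUnit n h : ℕ) :=
      Int.ediv_le_ediv hU (by linarith [show (1 : ℤ) ≤ (shearUnit n h : ℕ) from by exact_mod_cast (show 1 ≤ shearUnit n h by unfold shearUnit; omega)])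
    rw [Int.add_ediv_of_dvd_right (dvd_refl _), Int.ediv_self hU.ne'] at this
    exact this
  constructor <;> linarith

/-- **The anchor mismatch of `j ≤ 800` v-strides**: `|Δ·(σj) − U·(σj·W_B)| ≤ 800·(n + U)` when `nℓ − n < Δ ≤ nℓ`. [folklore] -/
theorem anchor_le {n : ℕ} (hn : 1 ≤ n) (ℓ : ℕ) {h v vβ : ℤ} (hΔlo : (n : ℤ) * ℓ - n < modulus n h v vβ) (hΔhi : modulus n h v vβ ≤ (n : ℤ) * ℓ)
    {σ : ℤ} (hσ : σ = 1 ∨ σ = -1) {j : ℕ} (hj : j ≤ 800) :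
    |modulus n h v vβ * (σ * j) - (shearUnit n h : ℤ) * (σ * j * (Qw n ℓ h : ℕ))| ≤ 800 * (n + (shearUnit n h : ℤ)) := by
  obtain ⟨u1, u2⟩ := UQw_bounds hn ℓ h
  have hj' : (j : ℤ) ≤ 800 := by exact_mod_cast hj
  have hj0 : (0 : ℤ) ≤ j := by positivity
  have hσ1 : |σ| = 1 := by rcases hσ with rfl | rfl <;> simp
  have e : modulus n h v vβ * (σ * j) - (shearUnit n h : ℤ) * (σ * j * (Qw n ℓ h : ℕ)) =
      σ * ((j : ℤ) * (modulus n h v vβ - (shearUnit n h : ℤ) * (Qw n ℓ h : ℕ))) := by ring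
  rw [e, abs_mul, hσ1, one_mul, abs_mul, abs_of_nonneg hj0]
  have hd : |modulus n h v vβ - (shearUnit n h : ℤ) * (Qw n ℓ h : ℕ)| ≤ n + (shearUnit n h : ℤ) := by
    rw [abs_le]; constructor <;> linarith
  calc (j : ℤ) * |modulus n h v vβ - (shearUnit n h : ℤ) * (Qw n ℓ h : ℕ)| ≤ 800 * (n + (shearUnit n h : ℤ)) := by
        have h0 : (0 : ℤ) ≤ n + (shearUnit n h : ℤ) := by positivity
        nlinarith [abs_nonneg (modulus n h v vβ - (shearUnit n h : ℤ) * (Qw n ℓ h : ℕ))]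

section YBand

variable {A : ℤ} {n : ℕ} {h v vβ c₀' c₁' D : ℤ} {P : PCells2} {ℓ T : ℕ} {aW bL : ℤ}

/-- The y′-band record of the corridor along a v-direction `du` (`du.1 = 1`). [folklore] -/
theorem bandNw_y {du : MDir} (hd : du.1 = 1) :
    bandNw n ℓ h v T n NC (qy n ℓ h v T aW bL) NC (qy n ℓ h v T aW bL) (Wmy n v) (Wpy n v) du =
      yPrmXw n ℓ h v T (qy n ℓ h v T aW bL) NC (Wmy n v) (Wpy n v) := by
  have h10 : ¬ ((1 : Fin 2) = 0) := by decide
  simp [bandNw, hd, h10]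

/-- **The corner values of the y′-band record** at step `j`. [folklore] -/
theorem cornersY (j : ℕ) :
    let R := yPrmXw n ℓ h v T (qy n ℓ h v T aW bL) NC (Wmy n v) (Wpy n v)
    R.aLo j = (j : ℤ) * sA n ℓ h - (qy n ℓ h v T aW bL : ℕ) - j * T ∧ R.aHi j = (j : ℤ) * ((n : ℤ) * ℓ / (shearUnit n h : ℕ) + 1) + (qy n ℓ h v T aW bL : ℕ) + j * T ∧
      R.bLo j = (j : ℤ) * v - ((Wmy n v : ℕ) + (j : ℤ) * T) ∧ R.bHi j = (j : ℤ) * v + ((Wpy n v : ℕ) + (j : ℤ) * T) ∧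
      (R.ea : ℤ) = T ∧ (R.eb : ℤ) = T ∧ (R.La : ℤ) = ((3 * (n * ℓ) / shearUnit n h + 1 : ℕ) : ℤ) ∧ (R.Lb : ℤ) = n ∧ R.N = 799 :=
  ⟨rfl, rfl, rfl, rfl, rfl, rfl, rfl, rfl, rfl⟩

/-! ## §2 The regions of the y′-band -/

/-- **Every region of the y′-band reads inside the rooms with one unit of margin**, either corridor sign, under the three band floors `hby1`
(`U·(q_y + 800T + La + 1) + 2Δ ≤ 200Δ`), `hby2` (`U·(799·W_B + q_y + 800T + La + 1) + 2Δ ≤ 880Δ`), `hby3` (the drifting-box budget across with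
`B := Wmy + Wpy + 800T + n`, `ρ := 2397 + q_y + 800T + La`, `E := 800(n + U)`, `Y := 2r₀`). [cite: KozmaNitzan2024, §4 Lemma 11 (p. 22), Lemma 12] -/
theorem roomsBy (hn : 1 ≤ n) (hA : 0 < A) (hD : 0 < D) (hm : 0 < modulus n h v vβ) (hc₀ : 0 < c₀')
    (hsc0 : c₀' * A * (40 * modulus n h v vβ) = (P.r 0 : ℤ) * D) (hsc1 : c₁' * A * (40 * modulus n h v vβ) = (P.r 1 : ℤ) * D)
    (hΔlo : (n : ℤ) * ℓ - n < modulus n h v vβ) (hΔhi : modulus n h v vβ ≤ (n : ℤ) * ℓ) (hsT : (T : ℤ) + 1 ≤ sA n ℓ h)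
    (hby1 : (shearUnit n h : ℤ) * (((qy n ℓ h v T aW bL : ℕ) : ℤ) + 800 * T + (3 * (n * ℓ) / shearUnit n h + 1 : ℕ) + 1) + 2 * modulus n h v vβ ≤
      40 * 5 * modulus n h v vβ)
    (hby2 : (shearUnit n h : ℤ) * (799 * ((Qw n ℓ h : ℕ) : ℤ) + (qy n ℓ h v T aW bL : ℕ) + 800 * T + (3 * (n * ℓ) / shearUnit n h + 1 : ℕ) + 1) +
      2 * modulus n h v vβ ≤ 40 * 22 * modulus n h v vβ)
    (hby3 : (P.r 0 : ℤ) * (modulus n h v vβ * (((Wmy n v : ℕ) : ℤ) + (Wpy n v : ℕ) + 800 * T + n) +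
        |v| * ((shearUnit n h : ℤ) * ((2397 + ((qy n ℓ h v T aW bL : ℕ) : ℤ) + 800 * T + (3 * (n * ℓ) / shearUnit n h + 1 : ℕ)) + 1)) +
        |v| * (800 * (n + (shearUnit n h : ℤ)))) + 40 * modulus n h v vβ * n + (P.r 0 : ℤ) * n ≤ 40 * modulus n h v vβ * (n * (2 * (P.r 0 : ℤ))))
    {du : MDir} (hd : du.1 = 1) {j : ℕ} (hj : j ≤ 799) :
    let Bd := bandNw n ℓ h v T n NC (qy n ℓ h v T aW bL) NC (qy n ℓ h v T aW bL) (Wmy n v) (Wpy n v) du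
    let lo := dLo du.1 (sgOf du) 0 (Bd.aLo j - Bd.ea - Bd.La) (Bd.aHi j + Bd.ea + Bd.La) (Bd.bLo j - Bd.eb - Bd.Lb) (Bd.bHi j + Bd.eb + Bd.Lb)
    let hi := dHi du.1 (sgOf du) 0 (Bd.aLo j - Bd.ea - Bd.La) (Bd.aHi j + Bd.ea + Bd.La) (Bd.bLo j - Bd.eb - Bd.Lb) (Bd.bHi j + Bd.eb + Bd.Lb)
    (sgOf du = 1 → -(5 * (P.r du.1 : ℤ)) + 1 ≤ rdLo A n h v vβ c₀' c₁' D lo hi du.1 ∧ rdHi A n h v vβ c₀' c₁' D lo hi du.1 ≤ 22 * (P.r du.1 : ℤ) - 1) ∧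
    (sgOf du = -1 → -(5 * (P.r du.1 : ℤ)) + 1 ≤ -rdHi A n h v vβ c₀' c₁' D lo hi du.1 ∧ -rdLo A n h v vβ c₀' c₁' D lo hi du.1 ≤ 22 * (P.r du.1 : ℤ) - 1) ∧
    (-(2 * (P.r (oth du.1) : ℤ)) + 1 ≤ rdLo A n h v vβ c₀' c₁' D lo hi (oth du.1) ∧
      rdHi A n h v vβ c₀' c₁' D lo hi (oth du.1) ≤ 2 * (P.r (oth du.1) : ℤ) - 1) := by
  intro Bd lo hi
  dsimp only [Bd, lo, hi]
  rw [bandNw_y (n := n) (ℓ := ℓ) (h := h) (v := v) (T := T) (aW := aW) (bL := bL) hd, hd, oth_one']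
  obtain ⟨haLo, haHi, hbLo, hbHi, hea, heb, hLa, hLb, -⟩ := cornersY (n := n) (h := h) (v := v) (ℓ := ℓ) (T := T) (aW := aW) (bL := bL) j
  set R := yPrmXw n ℓ h v T (qy n ℓ h v T aW bL) NC (Wmy n v) (Wpy n v) with hR
  have hQ : ((Qw n ℓ h : ℕ) : ℤ) = (n : ℤ) * ℓ / (shearUnit n h : ℕ) + 1 := by unfold Qw; push_cast; rfl
  rw [← hQ] at haHi
  obtain ⟨hs1, hs2⟩ := sA_bounds hn ℓ h
  set Q : ℤ := ((Qw n ℓ h : ℕ) : ℤ) with hQdef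
  set La : ℤ := ((3 * (n * ℓ) / shearUnit n h + 1 : ℕ) : ℤ) with hLadef
  set qY : ℤ := ((qy n ℓ h v T aW bL : ℕ) : ℤ) with hqY
  set Bm : ℤ := qY + 800 * T + La with hBm
  set Bp : ℤ := 799 * Q + qY + 800 * T + La with hBp
  set B0 : ℤ := ((Wmy n v : ℕ) : ℤ) + (Wpy n v : ℕ) + 800 * T + n with hB0
  set ρ : ℤ := 2397 + qY + 800 * T + La with hρ
  have hj' : (j : ℤ) ≤ 799 := by exact_mod_cast hj
  have hj0 : (0 : ℤ) ≤ j := by positivity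
  have hT0 : (0 : ℤ) ≤ T := by positivity
  have hn0 : (0 : ℤ) ≤ n := by positivity
  have hq0 : (0 : ℤ) ≤ qY := by positivity
  have hLa0 : (0 : ℤ) ≤ La := by positivity
  have hQ0 : (0 : ℤ) ≤ Q := by positivity
  have hWm0 : (0 : ℤ) ≤ ((Wmy n v : ℕ) : ℤ) := by positivity
  have hWp0 : (0 : ℤ) ≤ ((Wpy n v : ℕ) : ℤ) := by positivity
  have hsA0 : (0 : ℤ) ≤ sA n ℓ h := by linarith
  have hjT : (j : ℤ) * T ≤ 799 * T := mul_le_mul_of_nonneg_right hj' hT0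
  have hjT0 : 0 ≤ (j : ℤ) * T := by positivity
  have hjQ : (j : ℤ) * Q ≤ 799 * Q := mul_le_mul_of_nonneg_right hj' hQ0
  have hjs0 : 0 ≤ (j : ℤ) * sA n ℓ h := by positivity
  have hjd : 0 ≤ (j : ℤ) * (Q - sA n ℓ h) ∧ (j : ℤ) * (Q - sA n ℓ h) ≤ 799 * 3 :=
    ⟨mul_nonneg hj0 (by linarith), mul_le_mul hj' (by linarith) (by linarith) (by norm_num)⟩
  -- the along corners
  have cLo : -Bm ≤ R.aLo j - R.ea - R.La := by rw [haLo, hea, hLa]; linarith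
  have cHi : R.aHi j + R.ea + R.La ≤ Bp := by rw [haHi, hea, hLa]; linarith
  -- the along corners about the anchor `j·W_B`
  have dLo' : |R.aLo j - R.ea - R.La - (j : ℤ) * Q| ≤ ρ := by
    rw [haLo, hea, hLa, abs_le]
    have e : (j : ℤ) * sA n ℓ h - qY - j * T - T - La - j * Q = -((j : ℤ) * (Q - sA n ℓ h)) - qY - j * T - T - La := by ring
    rw [e]; constructor <;> linarith [hjd.1, hjd.2]
  have dHi' : |R.aHi j + R.ea + R.La - (j : ℤ) * Q| ≤ ρ := by
    rw [haHi, hea, hLa, abs_le]; constructor <;> linarith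
  -- the across corners: `v·j ∓ B0`
  have eLo : v * j - B0 ≤ R.bLo j - R.eb - R.Lb := by rw [hbLo, heb, hLb]; linarith
  have eHi : R.bHi j + R.eb + R.Lb ≤ v * j + B0 := by rw [hbHi, heb, hLb]; linarith
  have hU0 : (0 : ℤ) ≤ (shearUnit n h : ℤ) := by positivity
  have hby1' : (shearUnit n h : ℤ) * Bm + 2 * modulus n h v vβ ≤ 40 * 5 * modulus n h v vβ := by
    have : (shearUnit n h : ℤ) * Bm ≤ (shearUnit n h : ℤ) * (Bm + 1) := mul_le_mul_of_nonneg_left (by linarith) hU0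
    linarith [hby1]
  have hby2' : (shearUnit n h : ℤ) * Bp + 2 * modulus n h v vβ ≤ 40 * 22 * modulus n h v vβ := by
    have : (shearUnit n h : ℤ) * Bp ≤ (shearUnit n h : ℤ) * (Bp + 1) := mul_le_mul_of_nonneg_left (by linarith) hU0
    linarith [hby2]
  have hj8 : j ≤ 800 := by omega
  rcases sgOf_sign du with hs | hs <;> rw [hs]
  · obtain ⟨e1, e0, e1', e0'⟩ := dLoHi_one_zero 1 (R.aLo j - R.ea - R.La) (R.aHi j + R.ea + R.La) (R.bLo j - R.eb - R.Lb) (R.bHi j + R.eb + R.Lb)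
    rw [oth_one'] at e0 e0'
    set lo' := dLo 1 1 0 (R.aLo j - R.ea - R.La) (R.aHi j + R.ea + R.La) (R.bLo j - R.eb - R.Lb) (R.bHi j + R.eb + R.Lb) with hlo'
    set hi' := dHi 1 1 0 (R.aLo j - R.ea - R.La) (R.aHi j + R.ea + R.La) (R.bLo j - R.eb - R.Lb) (R.bHi j + R.eb + R.Lb) with hhi'
    have k1 := readLo1_of_budget (A := A) (c₀' := c₀') (D := D) hD hm hsc1 (lo := lo') (hi := hi') (m := 5) (B := Bm) (by rw [e1]; exact cLo) hby1'
    have k2 := readHi1_of_budget (A := A) (c₀' := c₀') (D := D) hD hm hsc1 (lo := lo') (hi := hi') (m := 22) (B := Bp) (by rw [e1']; exact cHi) hby2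
    have hanch := anchor_le hn ℓ hΔlo hΔhi (Or.inl rfl : (1 : ℤ) = 1 ∨ (1 : ℤ) = -1) hj8
    have k3 := readAcross0_drift (c₁' := c₁') hn hA hD hm hc₀ hsc0 (lo := lo') (hi := hi') (t := 1 * j) (B := B0) (c := 1 * j * Q) (ρ := ρ)
      (E := 800 * (n + (shearUnit n h : ℤ))) (Y := 2 * (P.r 0 : ℤ))
      (by rw [e0]; linarith) (by rw [e0']; linarith) (by rw [e1, one_mul]; exact dLo') (by rw [e1', one_mul]; exact dHi') hanch hby3
    exact ⟨fun _ => ⟨by linarith, by linarith⟩, fun h1 => absurd h1 (by norm_num), by linarith [k3.1], by linarith [k3.2]⟩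
  · obtain ⟨e1, e0, e1', e0'⟩ := dLoHi_neg_zero 1 (R.aLo j - R.ea - R.La) (R.aHi j + R.ea + R.La) (R.bLo j - R.eb - R.Lb) (R.bHi j + R.eb + R.Lb)
    rw [oth_one'] at e0 e0'
    set lo' := dLo 1 (-1) 0 (R.aLo j - R.ea - R.La) (R.aHi j + R.ea + R.La) (R.bLo j - R.eb - R.Lb) (R.bHi j + R.eb + R.Lb) with hlo'
    set hi' := dHi 1 (-1) 0 (R.aLo j - R.ea - R.La) (R.aHi j + R.ea + R.La) (R.bLo j - R.eb - R.Lb) (R.bHi j + R.eb + R.Lb) with hhi'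
    have k1 := readHi1_of_budget (A := A) (c₀' := c₀') (D := D) hD hm hsc1 (lo := lo') (hi := hi') (m := 5) (B := Bm) (by rw [e1']; linarith) hby1
    have k2 := readLo1_of_budget (A := A) (c₀' := c₀') (D := D) hD hm hsc1 (lo := lo') (hi := hi') (m := 22) (B := Bp) (by rw [e1]; linarith) hby2'
    have hanch := anchor_le hn ℓ hΔlo hΔhi (Or.inr rfl : (-1 : ℤ) = 1 ∨ (-1 : ℤ) = -1) hj8
    have k3 := readAcross0_drift (c₁' := c₁') hn hA hD hm hc₀ hsc0 (lo := lo') (hi := hi') (t := -1 * j) (B := B0) (c := -1 * j * Q) (ρ := ρ)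
      (E := 800 * (n + (shearUnit n h : ℤ))) (Y := 2 * (P.r 0 : ℤ))
      (by rw [e0]; linarith) (by rw [e0']; linarith)
      (by rw [e1, show -(R.aHi j + ↑R.ea + ↑R.La) - -1 * ↑j * Q = -(R.aHi j + ↑R.ea + ↑R.La - ↑j * Q) by ring, abs_neg]; exact dHi')
      (by rw [e1', show -(R.aLo j - ↑R.ea - ↑R.La) - -1 * ↑j * Q = -(R.aLo j - ↑R.ea - ↑R.La - ↑j * Q) by ring, abs_neg]; exact dLo') hanch hby3
    exact ⟨fun h1 => absurd h1 (by norm_num), fun _ => ⟨by linarith, by linarith⟩, by linarith [k3.1], by linarith [k3.2]⟩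

end YBand

end CorrRec

end Skelφ

end Transplant

end Summit.CriticalPhenomena.PercolationContinuityZ3.Theorems

end
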